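import Literature.InformationTheory.QuantumCodes.QuantumSingletonBound
import Literature.InformationTheory.QuantumCodes.LocalityBounds
import Literature.InformationTheory.QuantumCodes.LocalCodeDistanceBound
import Literature.InformationTheory.QuantumCodes.StabilizerErrorCorrection
import Literature.InformationTheory.QuantumCodes.AdditiveCodeCorrection
import HarnessLib

/-!
# Correctable regions of a stabilizer code: union, holographic bound `k ≤ |C|`, expansion

Bravyi–Poulin–Terhal, *Tradeoffs for reliable quantum information storage in 2D systems*, Phys. Rev. Lett. 104
(2010) 050503 = arXiv:0909.5200 [BravyiPoulinTerhal2010]. The Letter proves `kd² = O(n)` for 2D commuting-projector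
codes from three region lemmas: the ENTROPIC BOUND «`Λ = ABC`, `A` and `B` correctable ⇒ `k = S(Λ) ≤ S(C) ≤ |C|`»
(Fact 1 and Eqs. (5)–(8)), the UNION LEMMA (Lemma 2: correctable regions such that every projector overlaps at most
one of them have a correctable union) and the EXPANSION COROLLARY (Cor. 1 of the Disentangling Lemma 1: «Let `M` be
any correctable region. Consider any regions `B ⊆ M` and `C ⊆ M̄` such that `BC` is correctable and `∂M ⊆ BC`. Then
`M ∪ C` is also correctable»). This file PROVES the three lemmas for STABILIZER codes on qubits, in the binary
symplectic vocabulary of `SymplecticCodes.lean` / `QuantumSingletonBound.lean`, where the Disentangling Lemma is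
replaced by the Cleaning Lemma of Bravyi–Terhal 2009 which it generalises («This result can be regarded as a
generalization of the Cleaning Lemma from [BT09] beyond stabilizer codes», [BravyiPoulinTerhal2010, p. 2]) and which
the tree has proved (`sup_sympDual_inf_supportedOn_compl_eq`, `BravyiTerhal2009_cleaningLemma`). The geometric part
of the Letter (squares, the partition of Fig. 1) and the theorem `kd² ≤ c n` itself are in `LocalCodeTradeoff.lean`.

Vocabulary. For a stabilizer space `S̄ ≤ 𝔽₂^{2n}` and a set of qubits `M`, `IsCorrectableRegion S̄ M` says that no
non-trivial logical operator is supported inside `M`: `S̄⊥ ∩ P(M) ⊆ S̄` — for a stabilizer code this is exactly the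
Knill–Laflamme condition for the erasure of `M` (every Pauli operator on `M` is detected or is a stabilizer), i.e.
the Letter's «a region `M ⊆ Λ` is correctable iff there exists an error correction operation … that corrects the
erasure of all particles in `M`», and it is the negation of case (1) of the Cleaning Lemma. Generators: a family
`g : ι → 𝔽₂^{2n}` with `S̄ = span g` (over-complete families allowed); «projector `Π_a` overlaps region `M`» =
`sympSupport (g a)` meets `M`. Regions given by a LABELLING `β : qubits → Option ι` (the region is `{β ≠ none}`, its
blocks are the fibres `{β = some i}`) is how unions of blocks are handled without disjointness bookkeeping.

Contents: `IsCorrectableRegion` (+ `mono`, `of_card_lt` «any region of size smaller than `d` is correctable», `univ_iff`,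
and the Knill–Laflamme bridge `IsCorrectableRegion.isCorrectable_toOperator`: every family of Pauli errors supported
on a correctable region is an `IsCorrectable` set of errors for the stabilizer code, via Thm. 10.8 of
`StabilizerErrorCorrection.lean`; and, appended, the EQUIVALENCE `isCorrectableRegion_iff_isCorrectable_toOperator`
for independent rows via CRSS Lemma 1 of `AdditiveCodeCorrection.lean`); appended too: the exact counts
`finrank_supportedOn_eq` (`dim P(M) = 2|M|`), `finrank_sympDual_inf_supportedOn_add` (the cleaning count with
equality) and the LOGICAL-OPERATOR COUNT `finrank_logical_add_finrank_logical_compl` — `l(M) + l(M̄) = 2k` for every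
region (Bravyi 2011 Lemma 2 for stabilizer codes = Yoshida–Chuang 2010), with `isCorrectableRegion_iff_finrank_eq`
(`M` correctable iff `l(M) = 0`) and `isCorrectableRegion_iff_finrank_compl` (iff `l(M̄) = 2k`) [Bravyi2011Subsystem];
`fiber`, `eq_sum_proj_fiber`; UNION `isCorrectableRegion_of_fibers` (Lemma 2, family form); HOLOGRAPHIC BOUND
`le_card_compl_of_isCorrectable` (`k ≤ |Λ ∖ (A ∪ B)|`); EXPANSION `IsCorrectableRegion.union_of_crossing` (Cor. 1, with the
boundary hypothesis «every generator meeting both `M` and `M̄` is supported in `F`», `F` playing the role of `BC`).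

## References

* [BravyiPoulinTerhal2010] arXiv:0909.5200: definitions (chunk p0003 L165–181), Eqs. (5)–(8) (p0004 L244–255),
  Cor. 1 (p0004 L275–279), Def. 1 (p0004 L312–319), Lemma 2 (p0005 L443–449).
* [BravyiTerhal2009] §2 Lemma 1 (Cleaning Lemma) — proved in `QuantumSingletonBound.lean`.
* [Bravyi2011Subsystem] S. Bravyi, *Subsystem codes with spatially local generators*, Phys. Rev. A 83 (2011)
  012320 = arXiv:1008.1029: §6 Lemma 2 and its stabilizer specialisation `l(M) + l(M̄) = 2k` (chunk p0011
  L54–L62), §7–§8 (the rigorous stabilizer-language version of the BPT10 argument).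

## Mathlib / tree search

Tree: `supportedOn`, `proj`, `proj_add_proj_compl`, `sympInner_proj_right`, `sympInner_eq_zero_of_supportedOn_compl`,
`finrank_supportedOn_le`, `sympWeight_le_card_of_mem`, `sup_sympDual_inf_supportedOn_compl_eq`
(QuantumSingletonBound.lean); `sympSupport` (LocalityBounds.lean); `mem_sympDual_span_of_forall`, `sympInner_sum_right`,
`mem_supportedOn_compl_of_forall_sympSupport` (LocalCodeDistanceBound.lean); `sympDual_sympDual`,
`IsAdditiveCode.finrank_sympDual` (SymplecticCodes.lean). No prior notion of a correctable region in the tree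
(`lean search 'orrectable'`: decoder-side `Corrects…` predicates only).
-/

namespace Literature.InformationTheory.QuantumCodes

open Matrix Finset Module

variable {n : ℕ}

/-! ### Correctable regions -/

/-- **Correctable region** of a stabilizer code, symplectic form: `M` is correctable for `S̄` iff no non-trivial
logical operator is supported inside `M`, i.e. `S̄⊥ ∩ P(M) ⊆ S̄` (every Pauli operator acting only on `M` that
commutes with the stabilizer is itself a stabilizer — the Knill–Laflamme condition for the erasure of `M`). Printed:
«a region `M ⊆ Λ` is correctable iff there exists an error correction operation (a trace preserving completely positive
map) `𝓡` that corrects the erasure of all particles in `M`»; for stabilizer codes this is the negation of case (1) of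
the Cleaning Lemma («There exists a non-trivial logical operator `P ∈ C(S)∖S` whose support is contained in `M`»).
[cite: BravyiPoulinTerhal2010, Definitions and notations (p. 2); BravyiTerhal2009, §2 Lemma 1 case (1)] -/
def IsCorrectableRegion (S : Submodule (ZMod 2) (SympVec n)) (M : Finset (Fin n)) : Prop :=
  ∀ v ∈ sympDual S, v ∈ supportedOn M → v ∈ S

/-- Lattice form of correctability: `S̄⊥ ∩ P(M) ≤ S̄`. [cite: BravyiTerhal2009, §2 Lemma 1] -/
theorem IsCorrectableRegion.inf_le {S : Submodule (ZMod 2) (SympVec n)} {M : Finset (Fin n)} (h : IsCorrectableRegion S M) :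
    (sympDual S ⊓ supportedOn M : Submodule (ZMod 2) (SympVec n)) ≤ S :=
  fun _ hv => h _ hv.1 hv.2

/-- `P(M') ≤ P(M)` for `M' ⊆ M`. [cite: BravyiTerhal2009, §2 (𝒫(M))] -/
theorem supportedOn_mono {M M' : Finset (Fin n)} (h : M' ⊆ M) : supportedOn M' ≤ supportedOn (n := n) M :=
  fun _ hv i hi => hv i fun hi' => hi (h hi')

/-- `P(X) ∩ P(Y) ≤ P(X ∩ Y)`. [cite: BravyiTerhal2009, §2 (𝒫(M))] -/
theorem mem_supportedOn_inter {X Y : Finset (Fin n)} {v : SympVec n} (hX : v ∈ supportedOn X)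
    (hY : v ∈ supportedOn Y) : v ∈ supportedOn (X ∩ Y) := by
  intro i hi
  rw [mem_inter, not_and_or] at hi
  rcases hi with hi | hi
  · exact hX i hi
  · exact hY i hi

/-- A vector whose support lies in `M` is supported on `M`. [cite: BravyiTerhal2009, §2 (support of an operator)] -/
theorem mem_supportedOn_of_forall_sympSupport {M : Finset (Fin n)} {v : SympVec n}
    (h : ∀ q ∈ sympSupport v, q ∈ M) : v ∈ supportedOn M := by
  have := mem_supportedOn_compl_of_forall_sympSupport (M := Mᶜ) (v := v) (fun q hq => by simpa using h q hq)
  simpa using this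

/-- A subregion of a correctable region is correctable. [cite: BravyiPoulinTerhal2010, Definitions and notations (p. 2)] -/
theorem IsCorrectableRegion.mono {S : Submodule (ZMod 2) (SympVec n)} {M M' : Finset (Fin n)} (h : IsCorrectableRegion S M)
    (hM' : M' ⊆ M) : IsCorrectableRegion S M' :=
  fun v hv hvM' => h v hv (supportedOn_mono hM' hvM')

/-- «By definition of the distance any region of size smaller than `d` is correctable.»
[cite: BravyiPoulinTerhal2010, Definitions and notations (p. 2)] -/
theorem IsCorrectableRegion.of_card_lt {S : Submodule (ZMod 2) (SympVec n)} {d : ℕ} (hdist : HasMinDist S d)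
    {M : Finset (Fin n)} (hM : #M < d) : IsCorrectableRegion S M := by
  intro v hv hvM
  by_contra hvS
  have h1 := hdist v hv hvS
  have h2 := sympWeight_le_card_of_mem hvM
  omega

/-- The whole lattice is correctable iff `S̄⊥ ≤ S̄`, i.e. iff the code has no logical qubits.
[cite: BravyiPoulinTerhal2010, p. 3 («In the case of trivial codes (k=0) … any region is correctable»)] -/
theorem isCorrectableRegion_univ_iff {S : Submodule (ZMod 2) (SympVec n)} :
    IsCorrectableRegion S univ ↔ sympDual S ≤ S :=
  ⟨fun h v hv => h v hv (fun i hi => absurd (mem_univ i) hi), fun h _ hv _ => h hv⟩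

/-- A code with `k ≥ 1` logical qubits has a non-correctable lattice.
[cite: BravyiPoulinTerhal2010, p. 3 («In the case of trivial codes (k=0) … any region is correctable»)] -/
theorem not_isCorrectableRegion_univ {S : Submodule (ZMod 2) (SympVec n)} {k d : ℕ} (hcode : IsAdditiveCode S k d)
    (hk : 1 ≤ k) : ¬ IsCorrectableRegion S univ := by
  intro h
  have hle := Submodule.finrank_mono (isCorrectableRegion_univ_iff.1 h)
  rw [hcode.finrank_sympDual] at hle
  have := hcode.2.1
  omega

/-- **A correctable region is correctable in the Knill–Laflamme sense** (faithfulness of `IsCorrectableRegion`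
to the printed «there exists an error correction operation … that corrects the erasure of all particles in `M`»):
for the stabilizer code of rows `gen` (any signs `s`) with `S̄ = ⟨gen⟩` self-orthogonal, if `M` is a correctable
region then EVERY family of Pauli errors supported on `M` is a correctable set of errors (`IsCorrectable`: a
trace-preserving recovery exists, Thm. 10.1/10.8 of `StabilizerCodeSpace.lean`): `e_j + e_k` is supported on `M`,
so it is a stabilizer or lies outside `S̄⊥`. (The tree's `isCorrectable_toOperator_of_supportedOn` is the special
case `|M| < d`.) [cite: BravyiPoulinTerhal2010, Definitions and notations (p. 2); NielsenChuang2010, Thm 10.8, p. 467] -/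
theorem IsCorrectableRegion.isCorrectable_toOperator {r : ℕ} {gen : Fin r → SympVec n}
    (hS : IsSelfOrthogonal (Submodule.span (ZMod 2) (Set.range gen))) (s : Fin r → ZMod 2)
    {M : Finset (Fin n)} (hM : IsCorrectableRegion (Submodule.span (ZMod 2) (Set.range gen)) M)
    {ι : Type*} [Fintype ι] {e : ι → SympVec n} (he : ∀ j, e j ∈ supportedOn M) :
    IsCorrectable (codeProjector (signedGenOps gen s)) (fun j => toOperator (e j)) := by
  refine isCorrectable_toOperator_of_forall_mem_or_not_mem_sympDual hS s fun j k => ?_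
  by_cases hdual : e j + e k ∈ sympDual (Submodule.span (ZMod 2) (Set.range gen))
  · exact Or.inl (hM _ hdual (Submodule.add_mem _ (he j) (he k)))
  · exact Or.inr hdual

/-! ### Restrictions -/

/-- `ρ_M` does not enlarge supports: `P ∈ P(X) ⇒ ρ_M P ∈ P(X)`. [cite: BravyiTerhal2009, §2 (restriction P_M)] -/
theorem proj_mem_supportedOn_of_mem (M : Finset (Fin n)) {X : Finset (Fin n)} {P : SympVec n}
    (hP : P ∈ supportedOn X) : proj M P ∈ supportedOn X := by
  intro i hi
  constructor
  · simp only [proj_apply_fst]; split_ifs <;> simp [(hP i hi).1]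
  · simp only [proj_apply_snd]; split_ifs <;> simp [(hP i hi).2]

/-- `ρ_{M̄} P = P + ρ_M P` over `𝔽₂`. [cite: BravyiTerhal2009, §2 (P = P_M P_{M̄})] -/
theorem proj_compl_eq_add (M : Finset (Fin n)) (P : SympVec n) : proj Mᶜ P = P + proj M P := by
  ext i <;> by_cases hi : i ∈ M <;> simp [hi, CharTwo.add_self_eq_zero]

/-- `ρ_{M̄} P` of a vector `P ∈ P(Fᶜ)` is supported outside `M ∪ F`. [cite: BravyiTerhal2009, §2 (restriction P_M)] -/
theorem proj_compl_mem_supportedOn_compl_union {M F : Finset (Fin n)} {P : SympVec n}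
    (hP : P ∈ supportedOn Fᶜ) : proj Mᶜ P ∈ supportedOn (M ∪ F)ᶜ := by
  intro i hi
  rw [mem_compl, not_not, mem_union] at hi
  by_cases hiM : i ∈ M
  · simp [hiM]
  · have hiF : i ∈ F := hi.resolve_left hiM
    have := hP i (by simpa using hiF)
    simp [hiM, this.1, this.2]

/-! ### Fibres of a labelling -/

/-- The fibre (block) of label `o` of a labelling `β` of the qubits. [cite: BravyiPoulinTerhal2010, p. 2 («The regions A and B consist of blocks»)] -/
def fiber {κ : Type*} [DecidableEq κ] (β : Fin n → κ) (o : κ) : Finset (Fin n) := univ.filter fun q => β q = o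

/-- Membership in a fibre. [cite: BravyiPoulinTerhal2010, p. 2] -/
@[simp] theorem mem_fiber {κ : Type*} [DecidableEq κ] {β : Fin n → κ} {o : κ} {q : Fin n} :
    q ∈ fiber β o ↔ β q = o := by simp [fiber]

/-- Every vector is the sum of its restrictions to the fibres of a labelling (the fibres partition the qubits).
[cite: BravyiTerhal2009, §2 (restriction P_M; P = P_M P_{M̄})] -/
theorem eq_sum_proj_fiber {κ : Type*} [DecidableEq κ] (β : Fin n → κ) (P : SympVec n) :
    P = ∑ o ∈ univ.image β, proj (fiber β o) P := by
  have hmem : ∀ q : Fin n, β q ∈ univ.image β := fun q => mem_image_of_mem β (mem_univ q)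
  ext q
  · simp only [Prod.fst_sum, Finset.sum_apply, proj_apply_fst, mem_fiber, Finset.sum_ite_eq, if_pos (hmem q)]
  · simp only [Prod.snd_sum, Finset.sum_apply, proj_apply_snd, mem_fiber, Finset.sum_ite_eq, if_pos (hmem q)]

/-- The restriction to the unlabelled qubits of a vector supported on the labelled ones vanishes.
[cite: BravyiTerhal2009, §2 (restriction P_M)] -/
theorem proj_fiber_none_eq_zero {ι : Type*} [DecidableEq ι] (β : Fin n → Option ι) {P : SympVec n}
    (hP : P ∈ supportedOn (univ.filter fun q => (β q).isSome)) : proj (fiber β none) P = 0 := by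
  ext q
  · simp only [proj_apply_fst, mem_fiber, Prod.fst_zero, Pi.zero_apply]
    by_cases h : β q = none
    · rw [if_pos h]; exact (hP q (by simp [h])).1
    · rw [if_neg h]
  · simp only [proj_apply_snd, mem_fiber, Prod.snd_zero, Pi.zero_apply]
    by_cases h : β q = none
    · rw [if_pos h]; exact (hP q (by simp [h])).2
    · rw [if_neg h]

/-! ### Union Lemma (Lemma 2), family form -/

section Union

variable {ι : Type*} [DecidableEq ι] (β : Fin n → Option ι) {G : Type*} (g : G → SympVec n)

/-- If every generator meets at most one block and `P ∈ ⟨g⟩⊥` is supported on the union of the blocks, then each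
block piece of `P` lies in `⟨g⟩⊥` (a generator meeting block `i` meets no other block, so it sees only the `i`-th
piece of `P`). [cite: BravyiPoulinTerhal2010, Lemma 2 and its proof idea («an error acting on a region M_i creates non-trivial syndrome only in a small neighborhood of M_i»)] -/
theorem proj_fiber_mem_sympDual
    (hsep : ∀ a, ∀ q ∈ sympSupport (g a), ∀ q' ∈ sympSupport (g a), ∀ i i' : ι,
      β q = some i → β q' = some i' → i = i')
    {P : SympVec n} (hPd : P ∈ sympDual (Submodule.span (ZMod 2) (Set.range g)))
    (hPs : P ∈ supportedOn (univ.filter fun q => (β q).isSome)) (i : ι) :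
    proj (fiber β (some i)) P ∈ sympDual (Submodule.span (ZMod 2) (Set.range g)) := by
  refine mem_sympDual_span_of_forall g fun a => ?_
  by_cases hmeet : ∃ q ∈ sympSupport (g a), β q = some i
  · obtain ⟨q₀, hq₀, hq₀i⟩ := hmeet
    -- the generator is orthogonal to every OTHER piece of P
    have hother : ∀ o ∈ univ.image β, o ≠ some i → sympInner (g a) (proj (fiber β o) P) = 0 := by
      intro o _ hne
      rcases o with _ | i'
      · rw [proj_fiber_none_eq_zero β hPs]; simp [sympInner]
      · have hg : g a ∈ supportedOn (fiber β (some i'))ᶜ := by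
          refine mem_supportedOn_compl_of_forall_sympSupport fun q hq hqi' => ?_
          rw [mem_fiber] at hqi'
          exact hne (congrArg some (hsep a q hq q₀ hq₀ i' i hqi' hq₀i))
        rw [sympInner_comm]
        exact sympInner_eq_zero_of_supportedOn_compl (proj_mem_supportedOn _ P) hg
    have htot : sympInner (g a) P = 0 :=
      (mem_sympDual_iff.1 hPd) (g a) (Submodule.subset_span ⟨a, rfl⟩)
    rw [eq_sum_proj_fiber β P, sympInner_sum_right] at htot
    have himem : some i ∈ univ.image β := by
      rw [← hq₀i]; exact mem_image_of_mem β (mem_univ q₀)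
    rw [← Finset.add_sum_erase _ _ himem,
      Finset.sum_eq_zero (fun o ho => hother o (Finset.mem_of_mem_erase ho) (Finset.ne_of_mem_erase ho)),
      add_zero] at htot
    exact htot
  · push Not at hmeet
    have hg : g a ∈ supportedOn (fiber β (some i))ᶜ :=
      mem_supportedOn_compl_of_forall_sympSupport fun q hq hqi => hmeet q hq (by simpa using hqi)
    rw [sympInner_comm]
    exact sympInner_eq_zero_of_supportedOn_compl (proj_mem_supportedOn _ P) hg

/-- **Union Lemma (family form).** If `S̄ = ⟨g⟩`, every generator meets at most one block of the labelling `β`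
(«any projector `Π_a` overlaps with at most one of `M_1, M_2`»), and every block is correctable, then the union of
the blocks is correctable. Printed for two regions (Lemma 2, with the extra hypothesis «`∂_+ M_1` is also correctable»
that the stabilizer case does not need); the family form is how the Letter uses it for the block regions `A` and `B`
of Fig. 1 («It guarantees that the entire regions `A` and `B` are correctable»).
[cite: BravyiPoulinTerhal2010, Lemma 2 (p. 4) and p. 2 (application to the blocks of A and B)] -/
theorem isCorrectableRegion_of_fibers {S : Submodule (ZMod 2) (SympVec n)}
    (hS : S = Submodule.span (ZMod 2) (Set.range g))
    (hsep : ∀ a, ∀ q ∈ sympSupport (g a), ∀ q' ∈ sympSupport (g a), ∀ i i' : ι,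
      β q = some i → β q' = some i' → i = i')
    (hcorr : ∀ i, IsCorrectableRegion S (fiber β (some i))) :
    IsCorrectableRegion S (univ.filter fun q => (β q).isSome) := by
  intro P hPd hPs
  rw [eq_sum_proj_fiber β P]
  refine Submodule.sum_mem _ fun o _ => ?_
  rcases o with _ | i
  · rw [proj_fiber_none_eq_zero β hPs]; exact Submodule.zero_mem _
  · refine hcorr i _ ?_ (proj_mem_supportedOn _ P)
    subst hS
    exact proj_fiber_mem_sympDual β g hsep hPd hPs i

/-- **Union Lemma (Bravyi–Poulin–Terhal Lemma 2), stabilizer form.** «Let `M_1, M_2 ⊆ Λ` be any correctable regions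
such that any projector `Π_a` overlaps with at most one of `M_1, M_2`. [Suppose that `∂_+ M_1` is also correctable.]
Then the region `M_1 ∪ M_2` is correctable.» For stabilizer codes the bracketed hypothesis is not needed: the
`M_1`-part of a logical operator supported on `M_1 ∪ M_2` commutes with every generator (a generator meeting `M_1`
misses `M_2`), so it is a logical operator inside `M_1`, a stabilizer; likewise the rest, which lives in `M_2`.
[cite: BravyiPoulinTerhal2010, Lemma 2 (p. 4)] -/
theorem IsCorrectableRegion.union {S : Submodule (ZMod 2) (SympVec n)}
    (hS : S = Submodule.span (ZMod 2) (Set.range g)) {M₁ M₂ : Finset (Fin n)}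
    (hM₁ : IsCorrectableRegion S M₁) (hM₂ : IsCorrectableRegion S M₂)
    (hsep : ∀ a, (∃ q ∈ sympSupport (g a), q ∈ M₁) → ∀ q ∈ sympSupport (g a), q ∉ M₂) :
    IsCorrectableRegion S (M₁ ∪ M₂) := by
  intro P hPd hPs
  -- the part of P outside M₁ lives in M₂
  have hP2 : proj M₁ᶜ P ∈ supportedOn M₂ := by
    refine supportedOn_mono (fun i hi => ?_)
      (mem_supportedOn_inter (proj_mem_supportedOn M₁ᶜ P) (proj_mem_supportedOn_of_mem M₁ᶜ hPs))
    rw [mem_inter, mem_compl, mem_union] at hi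
    tauto
  -- the M₁-part of P commutes with every generator
  have hP1d : proj M₁ P ∈ sympDual S := by
    subst hS
    refine mem_sympDual_span_of_forall g fun a => ?_
    by_cases h1 : ∃ q ∈ sympSupport (g a), q ∈ M₁
    · have hg : g a ∈ supportedOn M₂ᶜ := mem_supportedOn_compl_of_forall_sympSupport (hsep a h1)
      have htot : sympInner (g a) P = 0 := (mem_sympDual_iff.1 hPd) (g a) (Submodule.subset_span ⟨a, rfl⟩)
      rw [← proj_add_proj_compl M₁ P, sympInner_comm, sympInner_add_left, sympInner_comm (proj M₁ᶜ P),
        sympInner_comm (g a), sympInner_eq_zero_of_supportedOn_compl hP2 hg, add_zero, sympInner_comm] at htot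
      exact htot
    · push Not at h1
      rw [sympInner_comm]
      exact sympInner_eq_zero_of_supportedOn_compl (proj_mem_supportedOn M₁ P)
        (mem_supportedOn_compl_of_forall_sympSupport h1)
  have hP1 : proj M₁ P ∈ S := hM₁ _ hP1d (proj_mem_supportedOn M₁ P)
  have hP2d : proj M₁ᶜ P ∈ sympDual S := by
    rw [proj_compl_eq_add]
    exact Submodule.add_mem _ hPd hP1d
  rw [← proj_add_proj_compl M₁ P]
  exact Submodule.add_mem _ hP1 (hM₂ _ hP2d hP2)

end Union

/-! ### The holographic bound `k ≤ |C|` (Eqs. (5)–(8)) -/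

/-- `dim T = dim f(T) + dim (T ∩ ker f)`. [folklore] -/
private theorem finrank_eq_finrank_map_add' (f : SympVec n →ₗ[ZMod 2] SympVec n)
    (T : Submodule (ZMod 2) (SympVec n)) :
    finrank (ZMod 2) T = finrank (ZMod 2) (T.map f) +
      finrank (ZMod 2) (T ⊓ LinearMap.ker f : Submodule (ZMod 2) (SympVec n)) := by
  have h := LinearMap.finrank_range_add_finrank_ker (f.domRestrict T)
  rw [LinearMap.range_domRestrict, LinearMap.ker_domRestrict] at h
  rw [← h, ← Submodule.finrank_map_subtype_eq T (Submodule.comap T.subtype (LinearMap.ker f)),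
    Submodule.map_comap_subtype]

/-- If `A` is correctable, the logical operators supported away from `A` represent every logical class with
multiplicity exactly the stabilizers supported away from `A`: `dim S̄⊥(Aᶜ) = dim S̄(Aᶜ) + 2k` (cleaning off `A`).
[cite: BravyiPoulinTerhal2010, Eq. (5) («S(A|BC) = −S(A)») with BravyiTerhal2009 §2 Lemma 1] -/
theorem finrank_sympDual_inf_supportedOn_compl_eq {S : Submodule (ZMod 2) (SympVec n)} {k d : ℕ}
    (hcode : IsAdditiveCode S k d) {A : Finset (Fin n)} (hA : IsCorrectableRegion S A) :
    finrank (ZMod 2) (sympDual S ⊓ supportedOn Aᶜ : Submodule (ZMod 2) (SympVec n)) =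
      finrank (ZMod 2) (S ⊓ supportedOn Aᶜ : Submodule (ZMod 2) (SympVec n)) + 2 * k := by
  have hself := hcode.1
  have hclean := sup_sympDual_inf_supportedOn_compl_eq hself hA.inf_le
  have hsup := Submodule.finrank_sup_add_finrank_inf_eq S
    (sympDual S ⊓ supportedOn Aᶜ : Submodule (ZMod 2) (SympVec n))
  have hinf : (S ⊓ (sympDual S ⊓ supportedOn Aᶜ) : Submodule (ZMod 2) (SympVec n)) = S ⊓ supportedOn Aᶜ := by
    rw [← inf_assoc, inf_eq_left.2 hself]
  rw [hinf, hclean, hcode.finrank_sympDual] at hsup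
  have hdim := hcode.2.1
  omega

/-- **Holographic bound `k ≤ |C|`.** If the qubits split as `Λ = A ⊔ B ⊔ C` with `A` and `B` correctable, then
`k ≤ |C|`. Printed (entropic form): «Applying Eq. (4) to regions `A` and `B` yields `S(A|BC) = −S(A)`,
`S(B|AC) = −S(B)` … Adding together … yields `k = S(Λ) ≤ S(C) ≤ |C|`.» Stabilizer proof: clean every logical operator
off `A` (Cleaning Lemma); two cleaned representatives with the same restriction to `C` differ by an element of
`S̄⊥` supported on `B`, a stabilizer; hence `4^k ≤ 4^{|C|}`. Here `C = Λ ∖ (A ∪ B)` (`A`, `B` need not be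
disjoint: `A ∩ B` may be counted in either). [cite: BravyiPoulinTerhal2010, Eqs. (5)–(8) (p. 2)] -/
theorem le_card_compl_of_isCorrectable {S : Submodule (ZMod 2) (SympVec n)} {k d : ℕ}
    (hcode : IsAdditiveCode S k d) {A B : Finset (Fin n)} (hA : IsCorrectableRegion S A) (hB : IsCorrectableRegion S B) :
    k ≤ #(A ∪ B)ᶜ := by
  have h2k := finrank_sympDual_inf_supportedOn_compl_eq hcode hA
  -- restrict T = S⊥(Aᶜ) to C = (A ∪ B)ᶜ
  have hrk := finrank_eq_finrank_map_add' (proj (A ∪ B)ᶜ)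
    (sympDual S ⊓ supportedOn Aᶜ : Submodule (ZMod 2) (SympVec n))
  rw [ker_proj, compl_compl] at hrk
  have hmap : finrank (ZMod 2) ((sympDual S ⊓ supportedOn Aᶜ : Submodule (ZMod 2) (SympVec n)).map
      (proj (A ∪ B)ᶜ)) ≤ 2 * #(A ∪ B)ᶜ :=
    (Submodule.finrank_mono (by rintro _ ⟨v, -, rfl⟩; exact proj_mem_supportedOn _ v)).trans
      (finrank_supportedOn_le _)
  -- the kernel: elements of S⊥ supported on Aᶜ ∩ (A ∪ B) ⊆ B are stabilizers
  have hker : (sympDual S ⊓ supportedOn Aᶜ ⊓ supportedOn (A ∪ B) : Submodule (ZMod 2) (SympVec n)) ≤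
      S ⊓ supportedOn Aᶜ := by
    rintro v ⟨⟨hvd, hvA⟩, hvAB⟩
    refine ⟨hB v hvd ?_, hvA⟩
    refine supportedOn_mono (fun i hi => ?_) (mem_supportedOn_inter hvA hvAB)
    rw [mem_inter, mem_compl, mem_union] at hi
    tauto
  have hker' := Submodule.finrank_mono hker
  omega

/-! ### Expansion (Corollary 1 of the Disentangling Lemma) -/

section Expansion

variable {G : Type*} (g : G → SympVec n)

/-- Key step of the expansion: if every generator meeting both `M` and `M̄` is supported in `F`, and `P ∈ ⟨g⟩⊥`
is supported OFF `F`, then the `M`-part of `P` is again in `⟨g⟩⊥` (a generator inside `M` sees only `P_M`; a generator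
inside `M̄` does not see it; a crossing generator lives in `F`, where `P_M` vanishes).
[cite: BravyiPoulinTerhal2010, proof of Cor. 1 (p. 4) and Def. 1 (∂M)] -/
theorem proj_mem_sympDual_of_crossing {M F : Finset (Fin n)}
    (hcross : ∀ a, (∃ q ∈ sympSupport (g a), q ∈ M) → (∃ q ∈ sympSupport (g a), q ∉ M) →
      ∀ q ∈ sympSupport (g a), q ∈ F)
    {P : SympVec n} (hPd : P ∈ sympDual (Submodule.span (ZMod 2) (Set.range g)))
    (hPF : P ∈ supportedOn Fᶜ) : proj M P ∈ sympDual (Submodule.span (ZMod 2) (Set.range g)) := by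
  refine mem_sympDual_span_of_forall g fun a => ?_
  by_cases h1 : ∃ q ∈ sympSupport (g a), q ∈ M
  · by_cases h2 : ∃ q ∈ sympSupport (g a), q ∉ M
    · -- crossing generator: supported in F, while ρ_M P is supported off F
      have hg : g a ∈ supportedOn F := mem_supportedOn_of_forall_sympSupport (hcross a h1 h2)
      exact sympInner_eq_zero_of_supportedOn_compl hg (proj_mem_supportedOn_of_mem M hPF)
    · -- generator inside M
      push Not at h2
      have hg : g a ∈ supportedOn M := mem_supportedOn_of_forall_sympSupport fun q hq => by
        simpa using h2 q hq
      rw [sympInner_proj_right hg]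
      exact (mem_sympDual_iff.1 hPd) (g a) (Submodule.subset_span ⟨a, rfl⟩)
  · -- generator inside M̄
    push Not at h1
    have hg : g a ∈ supportedOn Mᶜ := mem_supportedOn_compl_of_forall_sympSupport h1
    rw [sympInner_comm]
    exact sympInner_eq_zero_of_supportedOn_compl (proj_mem_supportedOn M P) hg

/-- **Expansion (Bravyi–Poulin–Terhal Cor. 1), stabilizer form.** Let `S̄ = ⟨g⟩` be self-orthogonal, `M` a
correctable region and `F` a correctable region containing the boundary of `M` in the sense that every generator
meeting both `M` and `M̄` is supported inside `F` («`∂M ⊆ BC`», `F = BC`). Then `M ∪ F` is correctable. Printed: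
«Corollary 1. Let `M` be any correctable region. Consider any regions `B ⊆ M` and `C ⊆ M̄` such that `BC` is
correctable and `∂M ⊆ BC`. Then `M ∪ C` is also correctable.» (`M ∪ C = M ∪ BC`.) Proof: clean a logical operator off
`F` (Cleaning Lemma); its `M`-part is then a logical operator inside `M`, hence a stabilizer, so every logical class
has a representative supported outside `M ∪ F`, which commutes with every `Q ∈ S̄⊥ ∩ P(M ∪ F)`; thus such `Q` lie in
`S̄⊥⊥ = S̄`. [cite: BravyiPoulinTerhal2010, Cor. 1 (p. 4)] -/
theorem IsCorrectableRegion.union_of_crossing {S : Submodule (ZMod 2) (SympVec n)}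
    (hS : S = Submodule.span (ZMod 2) (Set.range g)) (hself : IsSelfOrthogonal S) {M F : Finset (Fin n)}
    (hM : IsCorrectableRegion S M) (hF : IsCorrectableRegion S F)
    (hcross : ∀ a, (∃ q ∈ sympSupport (g a), q ∈ M) → (∃ q ∈ sympSupport (g a), q ∉ M) →
      ∀ q ∈ sympSupport (g a), q ∈ F) :
    IsCorrectableRegion S (M ∪ F) := by
  have hclean := sup_sympDual_inf_supportedOn_compl_eq hself hF.inf_le
  intro Q hQd hQs
  rw [← sympDual_sympDual S, mem_sympDual_iff]
  intro P hP
  rw [← hclean] at hP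
  obtain ⟨s, hs, P', ⟨hP'd, hP'F⟩, rfl⟩ := Submodule.mem_sup.1 hP
  -- ⟨s, Q⟩ = 0 since Q ∈ S⊥
  have h1 : sympInner s Q = 0 := (mem_sympDual_iff.1 hQd) s hs
  -- the M-part of P' is a stabilizer
  have hM' : proj M P' ∈ S := by
    refine hM _ ?_ (proj_mem_supportedOn M P')
    subst hS
    exact proj_mem_sympDual_of_crossing g hcross hP'd hP'F
  have h2 : sympInner (proj M P') Q = 0 := (mem_sympDual_iff.1 hQd) _ hM'
  -- the rest of P' lives outside M ∪ F
  have h3 : sympInner (proj Mᶜ P') Q = 0 := by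
    rw [sympInner_comm]
    exact sympInner_eq_zero_of_supportedOn_compl hQs (proj_compl_mem_supportedOn_compl_union hP'F)
  rw [sympInner_add_left, h1, zero_add, ← proj_add_proj_compl M P', sympInner_add_left, h2, h3, add_zero]

end Expansion

/-! ### Correctable regions = correctable erasures (Knill–Laflamme), both directions -/

/-- **`IsCorrectableRegion` is exactly Knill–Laflamme correctability of the erasure of `M`** (faithfulness, both
directions): for linearly independent self-orthogonal rows `gen` (any signs `s`), the region `M` is correctable
for `S̄ = ⟨gen⟩` in the symplectic sense iff the family of ALL Pauli errors supported on `M` is an `IsCorrectable`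
set of errors for the stabilizer code (a trace-preserving recovery exists) — by CRSS Lemma 1 / Gottesman §3.2 in
the tree's form `isCorrectable_toOperator_iff_of_linearIndependent` (`E(e)E(e')` correctable iff
`e + e' ∈ S̄ ∪ (Ē ∖ S̄⊥)`), since `P(M)` is closed under addition and contains `0`. This is the printed notion
«there exists an error correction operation … that corrects the erasure of all particles in `M`».
[cite: BravyiPoulinTerhal2010, Definitions and notations (p. 2); CalderbankEtAl1998, §2 Lemma 1 (printed p. 6)] -/
theorem isCorrectableRegion_iff_isCorrectable_toOperator {r : ℕ} {gen : Fin r → SympVec n}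
    (hS : IsSelfOrthogonal (Submodule.span (ZMod 2) (Set.range gen))) (hli : LinearIndependent (ZMod 2) gen)
    (s : Fin r → ZMod 2) (M : Finset (Fin n)) :
    IsCorrectableRegion (Submodule.span (ZMod 2) (Set.range gen)) M ↔
      IsCorrectable (codeProjector (signedGenOps gen s))
        (fun v : {v : SympVec n // ∀ i, i ∉ M → v.1 i = 0 ∧ v.2 i = 0} => toOperator (v : SympVec n)) := by
  rw [isCorrectable_toOperator_iff_of_linearIndependent hS hli s]
  constructor
  · intro h v w
    by_cases hvw : (v : SympVec n) + w ∈ sympDual (Submodule.span (ZMod 2) (Set.range gen))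
    · exact Or.inl (h _ hvw (Submodule.add_mem (supportedOn M) v.2 w.2))
    · exact Or.inr hvw
  · intro h v hvd hvM
    rcases h ⟨v, hvM⟩ ⟨0, (supportedOn M).zero_mem⟩ with h1 | h1
    · simpa using h1
    · exact absurd (by simpa using hvd) h1

/-! ### The logical-operator count `l(M) + l(M̄) = 2k` (Bravyi 2011, Lemma 2; Yoshida–Chuang) -/

/-- `P(M) + P(M̄) = Ē`: every Pauli operator is its `M`-part times its `M̄`-part.
[cite: Bravyi2011Subsystem, §6 (𝒫(M); restrictions onto M and M̄)] -/
theorem supportedOn_sup_compl (M : Finset (Fin n)) : supportedOn M ⊔ supportedOn Mᶜ = (⊤ : Submodule (ZMod 2) (SympVec n)) := by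
  refine eq_top_iff.2 fun v _ => ?_
  rw [← proj_add_proj_compl M v]
  exact Submodule.add_mem_sup (proj_mem_supportedOn M v) (proj_mem_supportedOn Mᶜ v)

/-- `P(M) ∩ P(M̄) = 1`: only the identity is supported on both `M` and `M̄`.
[cite: Bravyi2011Subsystem, §6 (𝒫(M))] -/
theorem supportedOn_inf_compl (M : Finset (Fin n)) : supportedOn M ⊓ supportedOn Mᶜ = (⊥ : Submodule (ZMod 2) (SympVec n)) := by
  refine eq_bot_iff.2 fun v hv => ?_
  rw [Submodule.mem_bot]
  ext i <;> by_cases hi : i ∈ M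
  · exact (hv.2 i (by simpa using hi)).1
  · exact (hv.1 i hi).1
  · exact (hv.2 i (by simpa using hi)).2
  · exact (hv.1 i hi).2

/-- **`dim P(M) = 2|M|`** («`dim 𝒫(M) = 2|M|`»). [cite: Bravyi2011Subsystem, §6 (chunk p0011: «dim 𝒫 = 2n and dim 𝒫(M) = 2|M|»)] -/
theorem finrank_supportedOn_eq (M : Finset (Fin n)) : finrank (ZMod 2) (supportedOn M) = 2 * #M := by
  have h := Submodule.finrank_sup_add_finrank_inf_eq (supportedOn M) (supportedOn (n := n) Mᶜ)
  rw [supportedOn_sup_compl, supportedOn_inf_compl, finrank_top, finrank_bot, finrank_sympVec] at h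
  have h1 := finrank_supportedOn_le M
  have h2 := finrank_supportedOn_le (Mᶜ : Finset (Fin n))
  have hc : #(Mᶜ : Finset (Fin n)) + #M = n := by
    rw [Finset.card_compl, Fintype.card_fin]
    have := card_le_univ M; rw [Fintype.card_fin] at this; omega
  omega

/-- Equality in the cleaning decomposition: `ρ_M(S̄)⊥ = P(M̄) ⊕ S̄⊥(M)` (the tree's `sympDual_map_proj_le` is `≤`).
[cite: BravyiTerhal2009, §2 Lemma 1 (proof); Bravyi2011Subsystem, §6 Lemma 2] -/
theorem sympDual_map_proj_eq (S : Submodule (ZMod 2) (SympVec n)) (M : Finset (Fin n)) :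
    sympDual (S.map (proj M)) = supportedOn Mᶜ ⊔ (sympDual S ⊓ supportedOn M) := by
  refine le_antisymm (sympDual_map_proj_le S M) (sup_le ?_ ?_)
  · intro w hw
    rw [mem_sympDual_iff]
    rintro _ ⟨s, -, rfl⟩
    exact sympInner_eq_zero_of_supportedOn_compl (proj_mem_supportedOn M s) hw
  · rintro v ⟨hvd, hvM⟩
    rw [mem_sympDual_iff]
    rintro _ ⟨s, hs, rfl⟩
    rw [sympInner_comm, sympInner_proj_right hvM, sympInner_comm]
    exact (mem_sympDual_iff.1 hvd) s hs

/-- **Exact cleaning count:** `dim S̄⊥(M) + dim S̄ = 2|M| + dim S̄(M̄)` for every subspace `S̄` and region `M`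
(the tree's `finrank_sympDual_inf_supportedOn_ge` is the inequality `≥`).
[cite: Bravyi2011Subsystem, §6 Lemma 2 (proof) with BravyiTerhal2009 §2 Lemma 1] -/
theorem finrank_sympDual_inf_supportedOn_add (S : Submodule (ZMod 2) (SympVec n)) (M : Finset (Fin n)) :
    finrank (ZMod 2) (sympDual S ⊓ supportedOn M : Submodule (ZMod 2) (SympVec n)) + finrank (ZMod 2) S =
      2 * #M + finrank (ZMod 2) (S ⊓ supportedOn Mᶜ : Submodule (ZMod 2) (SympVec n)) := by
  have hA := finrank_eq_finrank_map_add' (proj M) S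
  rw [ker_proj] at hA
  have hD := finrank_sympDual_add (S.map (proj M))
  have hsup := Submodule.finrank_sup_add_finrank_inf_eq (supportedOn Mᶜ)
    (sympDual S ⊓ supportedOn M : Submodule (ZMod 2) (SympVec n))
  have hinf : (supportedOn Mᶜ ⊓ (sympDual S ⊓ supportedOn M) : Submodule (ZMod 2) (SympVec n)) = ⊥ := by
    refine eq_bot_iff.2 fun v hv => ?_
    rw [← supportedOn_inf_compl M]
    exact ⟨hv.2.2, hv.1⟩
  rw [← sympDual_map_proj_eq, hinf, finrank_bot, add_zero, finrank_supportedOn_eq] at hsup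
  have hc : #(Mᶜ : Finset (Fin n)) + #M = n := by
    rw [Finset.card_compl, Fintype.card_fin]
    have := card_le_univ M; rw [Fintype.card_fin] at this; omega
  omega

/-- **`l(M) + l(M̄) = 2k`** (Bravyi 2011, Lemma 2 for stabilizer codes; Yoshida–Chuang 2010): for a stabilizer space
`S̄` of dimension `n − k` and ANY set of qubits `M`, with `l(M) = dim S̄⊥(M) − dim S̄(M)` the number of independent
logical operators supported inside `M`: «Specializing Lemma 2 to stabilizer codes (`𝒢 = 𝒮`) one gets a simpler
statement `l(M) + l(M̄) = 2k` which coincides with the result proved in [Yoshida10]. Note that Lemma 2 does not need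
any spatial locality properties.» Typed additively (no ℕ-subtraction); self-orthogonality is not even needed.
(For a correctable `M`, `l(M) = 0`, this is `finrank_sympDual_inf_supportedOn_compl_eq` above.)
[cite: Bravyi2011Subsystem, §6 Lemma 2 (stabilizer specialization, chunk p0011 L54–L62)] -/
theorem finrank_logical_add_finrank_logical_compl {S : Submodule (ZMod 2) (SympVec n)} {k : ℕ}
    (hdim : finrank (ZMod 2) S + k = n) (M : Finset (Fin n)) :
    finrank (ZMod 2) (sympDual S ⊓ supportedOn M : Submodule (ZMod 2) (SympVec n)) +
        finrank (ZMod 2) (sympDual S ⊓ supportedOn Mᶜ : Submodule (ZMod 2) (SympVec n)) =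
      finrank (ZMod 2) (S ⊓ supportedOn M : Submodule (ZMod 2) (SympVec n)) +
        finrank (ZMod 2) (S ⊓ supportedOn Mᶜ : Submodule (ZMod 2) (SympVec n)) + 2 * k := by
  have h1 := finrank_sympDual_inf_supportedOn_add S M
  have h2 := finrank_sympDual_inf_supportedOn_add S Mᶜ
  rw [compl_compl] at h2
  have hc : #(Mᶜ : Finset (Fin n)) + #M = n := by
    rw [Finset.card_compl, Fintype.card_fin]
    have := card_le_univ M; rw [Fintype.card_fin] at this; omega
  omega

/-- Correctability as `l(M) = 0`: for a self-orthogonal `S̄`, `M` is correctable iff `dim S̄⊥(M) = dim S̄(M)`.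
[cite: Bravyi2011Subsystem, §7 («l(M) = 0 whenever |M| < d»; square boxes with l = 0)] -/
theorem isCorrectableRegion_iff_finrank_eq {S : Submodule (ZMod 2) (SympVec n)} (hself : IsSelfOrthogonal S)
    (M : Finset (Fin n)) :
    IsCorrectableRegion S M ↔
      finrank (ZMod 2) (sympDual S ⊓ supportedOn M : Submodule (ZMod 2) (SympVec n)) =
        finrank (ZMod 2) (S ⊓ supportedOn M : Submodule (ZMod 2) (SympVec n)) := by
  have hle : (S ⊓ supportedOn M : Submodule (ZMod 2) (SympVec n)) ≤ sympDual S ⊓ supportedOn M :=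
    inf_le_inf_right _ hself
  constructor
  · intro h
    exact le_antisymm (Submodule.finrank_mono (le_inf h.inf_le inf_le_right)) (Submodule.finrank_mono hle)
  · intro h v hv hvM
    have heq := Submodule.eq_of_le_of_finrank_le hle h.le
    have : v ∈ (sympDual S ⊓ supportedOn M : Submodule (ZMod 2) (SympVec n)) := ⟨hv, hvM⟩
    rw [← heq] at this
    exact this.1

/-- **A correctable region leaves all `2k` logical operators on its complement; conversely `l(M̄) = 2k` forces
`l(M) = 0`:** for an `[[n,k,d]]` stabilizer code and any `M`, `M` is correctable iff
`dim S̄⊥(M̄) = dim S̄(M̄) + 2k`. [cite: Bravyi2011Subsystem, §6 Lemma 2 and §8 («Applying Lemma 2 we get l(B) = 2k»)] -/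
theorem isCorrectableRegion_iff_finrank_compl {S : Submodule (ZMod 2) (SympVec n)} {k d : ℕ}
    (hcode : IsAdditiveCode S k d) (M : Finset (Fin n)) :
    IsCorrectableRegion S M ↔
      finrank (ZMod 2) (sympDual S ⊓ supportedOn Mᶜ : Submodule (ZMod 2) (SympVec n)) =
        finrank (ZMod 2) (S ⊓ supportedOn Mᶜ : Submodule (ZMod 2) (SympVec n)) + 2 * k := by
  rw [isCorrectableRegion_iff_finrank_eq hcode.1]
  have h := finrank_logical_add_finrank_logical_compl hcode.2.1 M
  have hle := Submodule.finrank_mono (inf_le_inf_right (supportedOn M) hcode.1 :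
    (S ⊓ supportedOn M : Submodule (ZMod 2) (SympVec n)) ≤ sympDual S ⊓ supportedOn M)
  omega

end Literature.InformationTheory.QuantumCodes
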